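import Summits.Ventures.QEC.Census.CertCoverBatch
import Summits.Ventures.QEC.Census.TwoBGA.TB_l6m24_A0_0_0_1_3_11_B0_0_1_11_5_4.CoreDefs
import HarnessLib

set_option Elab.async false
set_option maxRecDepth 200000

/-!
# `[[288,12,16]]` one-level cover certificate of `TB_l6m24_A0_0_0_1_3_11_B0_0_1_11_5_4` — LEVEL-1→0 coset problems 0…4 (deep problems [5] excluded: `ProbDeep*.lean`) as COMPACT data
(`ProbData`: U, f, σ, y₀, allow; qec-type-10 `CertCoverBatch.mkCoset` rebuilds each `CosetProb` in the kernel) + their verdict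
`probsOK cov covR hx hx1 D1 lxd 14` (one `decide +kernel`; 5 problems, depths f=0:2 f=1:1 f=2:2 f=3:0, est. 95.0 s).
qec-search-1 g5 (pattern of search-9 g5 `Probs*`); data from JSON `level10.problems` (sha256 fee0559d1bce5e88…). Data + decided check; KERNEL.
-/

namespace Summit.Ventures.QEC.Census.TB_l6m24_A0_0_0_1_3_11_B0_0_1_11_5_4

open Matrix Summit.Ventures.QEC.Census Literature.InformationTheory.QuantumCodes

/-- Problems 0…4 (5): `⟨U, f, σ, y₀, allow⟩`. -/
def probs00 : List ProbData := [
    ⟨99184107659620165615622, 1, 12393906999565221904, 99170272601015121346566, [0]⟩,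
    ⟨324518553729267268058195874021378, 0, 7277817272879546380, 324518553658431338469586766921728, [0]⟩,
    ⟨324518557300551984923567206826496, 0, 1770977714174930452482, 15347799296454942523392, [0]⟩,
    ⟨324518560923787632735767973069824, 2, 3541882948543324356610, 324518560911981644470999788553216, [0, 664613997892457936451903530140172288]⟩,
    ⟨324518563353447566072872440954881, 2, 2522015928868145156, 23611976529536369033217, [0, 649037107316853453566312041152512]⟩]

set_option maxHeartbeats 400000000 in
/-- Every problem of this chunk passes (`mkCoset` elimination + `cosetOKD` + fast `σ` + depth + `BU`-evenness + label checks). -/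
theorem probs00_ok : probsOK TB_l6m24_A0_0_0_1_3_11_B0_0_1_11_5_4.cov covR hx hx1 D1 lxd 14 probs00 = true := by
  decide +kernel

/-- Pointwise form. -/
theorem probs00_all : ∀ x ∈ TB_l6m24_A0_0_0_1_3_11_B0_0_1_11_5_4.probs00, probOK cov covR hx hx1 D1 lxd 14 x = true := by
  have h := probs00_ok
  rwa [probsOK, List.all_eq_true] at h

end Summit.Ventures.QEC.Census.TB_l6m24_A0_0_0_1_3_11_B0_0_1_11_5_4
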